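import Literature.Geometry.Lorentzian.KerrConvergence
import Literature.Geometry.Lorentzian.KerrEnergyIdentity
import HarnessLib

/-!
# The pure Lorentz boost with prescribed lab velocity

(family `gr`; namespace `Literature.Geometry.Lorentzian.Lorentz`.)

Mathlib has no Lorentz group; the tree's `Literature.Geometry.Lorentzian.lorentzGroup`
(`KerrConvergence.lean`) is the subgroup of `η`-isometric continuous linear automorphisms of `E4`,
but no non-trivial ELEMENT of it is constructed anywhere in the tree (`lean search 'boost'` finds
only `StationaryFinalStateDecomposition.boost`, the transport of a background by a given element).
Statements about black holes "moving apart inertially with velocities `Vᵢ`" (the motions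
`(Λᵢ, cᵢ)` of `FinalStateDecomposition`) need the element of `O(1,3)` whose world-line
`t ↦ Λ(t e₀)` has a PRESCRIBED lab velocity `v`, `‖v‖ < 1`: the pure boost.

## Contents

* `Lorentz.gamma v = (√(1 − ‖v‖²))⁻¹`, with `1 ≤ γ`, `γ² (1 − ‖v‖²) = 1` for `‖v‖ < 1`;
* `Lorentz.boostCLM v : E4 →L[ℝ] E4`, the linear map
  `(t, x̲) ↦ (γ(t + ⟪v, x̲⟫), x̲ + (γ²/(γ+1)·⟪v, x̲⟫ + γ t) v)` — the standard boost FROM the rest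
  frame of an observer with lab velocity `v` TO the lab frame, written with `γ²/(γ + 1)` in place of
  `(γ − 1)/‖v‖²` so that no division by `‖v‖` occurs (Jackson, *Classical Electrodynamics*, 3rd ed.,
  (11.19); O'Neill 1983, Ch. 9, pp. 233–236);
* `Lorentz.minkowski_boostCLM` : it preserves `η` (`‖v‖ < 1`);
* `Lorentz.boost v hv : lorentzGroup` (bijective because an `η`-isometry is injective by
  non-degeneracy of `η`, and `E4` is finite-dimensional), with `Lorentz.coe_boost_apply`,
  `Lorentz.boost_apply_basisVector_zero : boost v e₀ = (γ, γ v)`, hence Lorentz factor `γ`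
  (`boost_apply_basisVector_zero_zero`) and lab velocity `v` (`spatial_boost_apply_basisVector_zero`).

## Design

The map is assembled from continuous linear pieces (`EuclideanSpace.proj 0`, `E4.spatial`,
`innerSL`, `E4.spaceEmbed`, `smulRight`), so linearity and continuity are free and only the
pointwise formula (`boostCLM_apply_zero`, `spatial_boostCLM_apply`) is proved by unfolding.
-/

noncomputable section

open Literature.Geometry.Lorentzian

namespace Literature.Geometry.Lorentzian

namespace Lorentz

/-- The **Lorentz factor** `γ(v) = 1/√(1 − ‖v‖²)` of a lab velocity `v ∈ E3` (meaningful for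
`‖v‖ < 1`). Jackson, *Classical Electrodynamics* (3rd ed.), (11.17). [cite: ONeill1983, Ch. 9, pp. 233–236] -/
def gamma (v : E3) : ℝ := (Real.sqrt (1 - ‖v‖ ^ 2))⁻¹

/-- `0 < 1 − ‖v‖²` for a subluminal velocity (bookkeeping). [cite: ONeill1983, Ch. 9, pp. 233–236] -/
theorem one_sub_norm_sq_pos {v : E3} (hv : ‖v‖ < 1) : 0 < 1 - ‖v‖ ^ 2 := by
  nlinarith [norm_nonneg v]

/-- `γ > 0` (Jackson (11.17)). [cite: ONeill1983, Ch. 9, pp. 233–236] -/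
theorem gamma_pos {v : E3} (hv : ‖v‖ < 1) : 0 < gamma v :=
  inv_pos.mpr (Real.sqrt_pos.mpr (one_sub_norm_sq_pos hv))

/-- `γ² (1 − ‖v‖²) = 1` (Jackson (11.17)). [cite: ONeill1983, Ch. 9, pp. 233–236] -/
theorem gamma_sq_mul {v : E3} (hv : ‖v‖ < 1) : gamma v ^ 2 * (1 - ‖v‖ ^ 2) = 1 := by
  unfold gamma
  rw [inv_pow, Real.sq_sqrt (one_sub_norm_sq_pos hv).le, inv_mul_cancel₀ (one_sub_norm_sq_pos hv).ne']

/-- `1 ≤ γ` (Jackson (11.17)). [cite: ONeill1983, Ch. 9, pp. 233–236] -/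
theorem one_le_gamma {v : E3} (hv : ‖v‖ < 1) : 1 ≤ gamma v := by
  have h1 := gamma_sq_mul hv
  have h2 := gamma_pos hv
  nlinarith [norm_nonneg v, sq_nonneg (gamma v - 1)]

/-- **The pure boost with lab velocity `v`** as a continuous linear map of `E4`:
`(t, x̲) ↦ (γ(t + ⟪v, x̲⟫), x̲ + (γ²/(γ+1)·⟪v, x̲⟫ + γ t) v)`. Jackson, *Classical Electrodynamics*
(3rd ed.), (11.19) (with `(γ − 1)/β² = γ²/(γ + 1)`); O'Neill 1983, Ch. 9, pp. 233–236.
[cite: ONeill1983, Ch. 9, pp. 233–236] -/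
def boostCLM (v : E3) : E4 →L[ℝ] E4 :=
  (gamma v • ((EuclideanSpace.proj (0 : Fin 4) : E4 →L[ℝ] ℝ) +
      (innerSL ℝ v).comp E4.spatial)).smulRight (E4.basisVector 0) +
    E4.spaceEmbed.comp (E4.spatial +
      ((gamma v ^ 2 / (gamma v + 1)) • (innerSL ℝ v).comp E4.spatial +
        gamma v • (EuclideanSpace.proj (0 : Fin 4) : E4 →L[ℝ] ℝ)).smulRight v)

/-- Time component of the boost: `(Λ x)⁰ = γ (x⁰ + ⟪v, x̲⟫)` (Jackson (11.19)). [cite: ONeill1983, Ch. 9, pp. 233–236] -/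
theorem boostCLM_apply_zero (v : E3) (x : E4) :
    boostCLM v x 0 = gamma v * (x 0 + inner ℝ v (E4.spatial x)) := by
  simp [boostCLM, E4.spaceEmbed_apply, mul_add]

/-- Spatial part of the boost: `(Λ x)~ = x̲ + (γ²/(γ+1)·⟪v, x̲⟫ + γ x⁰) v` (Jackson (11.19)).
[cite: ONeill1983, Ch. 9, pp. 233–236] -/
theorem spatial_boostCLM_apply (v : E3) (x : E4) :
    E4.spatial (boostCLM v x) =
      E4.spatial x + (gamma v ^ 2 / (gamma v + 1) * inner ℝ v (E4.spatial x) + gamma v * x 0) • v := by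
  have h0 : E4.spatial (E4.basisVector 0) = 0 := by
    ext i
    simp [E4.spatial_apply, Fin.succ_ne_zero]
  simp [boostCLM, E4.spaceEmbed_apply, E4.spatial_ofTimeSpace, h0]

/-- `η(u, w) = −u⁰w⁰ + ⟪ũ, w̃⟫` (O'Neill 1983, Ch. 3, p. 55). [cite: ONeill1983, Ch. 3, p. 55] -/
theorem minkowski_bilin_eq_inner (u w : E4) :
    Minkowski.bilin u w = -(u 0 * w 0) + inner ℝ (E4.spatial u) (E4.spatial w) := by
  rw [Minkowski.bilin_apply]
  congr 1
  rw [show inner ℝ (E4.spatial u) (E4.spatial w) =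
      ∑ i : Fin 3, inner ℝ (E4.spatial u i) (E4.spatial w i) from PiLp.inner_apply _ _]
  refine Finset.sum_congr rfl fun i _ ↦ ?_
  rw [E4.spatial_apply, E4.spatial_apply, real_inner_eq_re_inner]
  simp [mul_comm]

/-- **The boost preserves the Minkowski form**: `η(Λx, Λy) = η(x, y)` for `‖v‖ < 1` — the defining
property of `O(1,3)`; with `s = ⟪v, x̲⟫`, `s' = ⟪v, ỹ⟫`, `β² = ‖v‖²`, `α = γ²/(γ+1)` it is the
polynomial identity `−γ²(x⁰+s)(y⁰+s') + (αs'+γy⁰)s + (αs+γx⁰)s' + (αs+γx⁰)(αs'+γy⁰)β² = −x⁰y⁰`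
given `γ²(1 − β²) = 1`. O'Neill 1983, Ch. 9, p. 234; Jackson (11.19). [cite: ONeill1983, Ch. 9, p. 234] -/
theorem minkowski_boostCLM {v : E3} (hv : ‖v‖ < 1) (x y : E4) :
    Minkowski.bilin (boostCLM v x) (boostCLM v y) = Minkowski.bilin x y := by
  rw [minkowski_bilin_eq_inner, minkowski_bilin_eq_inner, boostCLM_apply_zero, boostCLM_apply_zero,
    spatial_boostCLM_apply, spatial_boostCLM_apply]
  set γ := gamma v with hγ
  set s := inner ℝ v (E4.spatial x) with hs
  set s' := inner ℝ v (E4.spatial y) with hs'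
  have hγ1 : 1 ≤ γ := one_le_gamma hv
  have hγ0 : γ + 1 ≠ 0 := by positivity
  have hβ : ‖v‖ ^ 2 = 1 - (γ ^ 2)⁻¹ := by
    have h := gamma_sq_mul hv
    rw [← hγ] at h
    have hγ2 : γ ^ 2 ≠ 0 := by positivity
    field_simp
    linarith
  have hvv : inner ℝ v v = ‖v‖ ^ 2 := real_inner_self_eq_norm_sq v
  rw [inner_add_left, inner_add_right, inner_add_right, real_inner_smul_left, real_inner_smul_left,
    real_inner_smul_right, real_inner_smul_right, real_inner_comm v (E4.spatial x), ← hs,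
    ← hs', hvv, hβ]
  have hγne : γ ≠ 0 := by positivity
  field_simp
  ring

/-- An `η`-isometric linear map of `E4` is injective (non-degeneracy of `η`,
`Minkowski.bilin_nondegenerate`). O'Neill 1983, Ch. 9, p. 233. [cite: ONeill1983, Ch. 9, p. 233] -/
theorem injective_boostCLM {v : E3} (hv : ‖v‖ < 1) : Function.Injective (boostCLM v) := by
  refine (injective_iff_map_eq_zero (boostCLM v)).mpr fun x hx ↦ ?_
  refine Minkowski.bilin_nondegenerate x fun w ↦ ?_
  rw [← minkowski_boostCLM hv x w, hx, map_zero]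
  rfl

/-- **The pure boost with lab velocity `v`, `‖v‖ < 1`, as an element of the Lorentz group**
(`lorentzGroup`): bijective since injective on the finite-dimensional `E4`, and `η`-isometric
(`minkowski_boostCLM`). O'Neill 1983, Ch. 9, pp. 233–236; Jackson (11.19).
[cite: ONeill1983, Ch. 9, pp. 233–236] -/
def boost (v : E3) (hv : ‖v‖ < 1) : lorentzGroup :=
  ⟨(LinearEquiv.ofBijective (boostCLM v).toLinearMap
      ⟨injective_boostCLM hv, LinearMap.injective_iff_surjective.mp (injective_boostCLM hv)⟩
      ).toContinuousLinearEquiv,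
    fun x y ↦ minkowski_boostCLM hv x y⟩

/-- The boost element acts by `boostCLM` (bookkeeping). [cite: ONeill1983, Ch. 9, pp. 233–236] -/
@[simp]
theorem coe_boost_apply {v : E3} (hv : ‖v‖ < 1) (x : E4) :
    (boost v hv : E4 ≃L[ℝ] E4) x = boostCLM v x := rfl

/-- **The boost maps the time axis to the 4-velocity `(γ, γv)`**: `Λ e₀ = (γ, γ v)` (Jackson (11.19);
O'Neill 1983, Ch. 9). [cite: ONeill1983, Ch. 9, pp. 233–236] -/
theorem boost_apply_basisVector_zero {v : E3} (hv : ‖v‖ < 1) :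
    (boost v hv : E4 ≃L[ℝ] E4) (E4.basisVector 0) = E4.ofTimeSpace (gamma v) (gamma v • v) := by
  have h0 : E4.spatial (E4.basisVector 0) = 0 := by
    ext i
    simp [E4.spatial_apply, Fin.succ_ne_zero]
  rw [coe_boost_apply, ← E4.ofTimeSpace_time_spatial (boostCLM v (E4.basisVector 0)),
    E4.time_apply, boostCLM_apply_zero, spatial_boostCLM_apply, h0]
  simp

/-- The Lorentz factor of the boost is `γ(v)`: `(Λ e₀)⁰ = γ` (Jackson (11.17)). [cite: ONeill1983, Ch. 9, pp. 233–236] -/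
theorem boost_apply_basisVector_zero_zero {v : E3} (hv : ‖v‖ < 1) :
    ((boost v hv : E4 ≃L[ℝ] E4) (E4.basisVector 0)) 0 = gamma v := by
  rw [boost_apply_basisVector_zero, E4.ofTimeSpace_apply_zero]

/-- **The boost has lab velocity `v`**: `(Λ e₀)~ = (Λ e₀)⁰ • v` (Jackson (11.19)). [cite: ONeill1983, Ch. 9, pp. 233–236] -/
theorem spatial_boost_apply_basisVector_zero {v : E3} (hv : ‖v‖ < 1) :
    E4.spatial ((boost v hv : E4 ≃L[ℝ] E4) (E4.basisVector 0)) =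
      ((boost v hv : E4 ≃L[ℝ] E4) (E4.basisVector 0)) 0 • v := by
  rw [boost_apply_basisVector_zero_zero, boost_apply_basisVector_zero, E4.spatial_ofTimeSpace]

end Lorentz

end Literature.Geometry.Lorentzian

end
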